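import Mathlib.LinearAlgebra.Matrix.Rank
import Literature.MathematicalPhysics.QuantumLattice.FlatBandFerromagnetismWeighted
import HarnessLib

/-!
# Mielke's flat-band ferromagnetism theorem (general positive-semidefinite hopping)

Topic `MathematicalPhysics/QuantumLattice` (Hubbard family; rigorous ferromagnetism).

**Setting** [Mielke 1999, §2]. A Hubbard model on a finite set of sites `Λ` with a real symmetric
positive semidefinite hopping matrix `T` whose lowest eigenvalue `0` is `N_d`-fold degenerate, and
site-independent `U > 0` (`U_x ≡ U`; Mielke allows `U_x > 0`). We write `T` as a Gram matrix
`T = t Σ_{a ∈ A} |u_a⟩⟨u_a|` of a family of real vectors (`FlatBand.gramHopping`; every real PSD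
matrix is of this form), so that the degenerate single-particle ground space — the FLAT BAND — is the
common null space `𝒦 = {v | ⟨u_a, v⟩ = 0 ∀ a}` (`flatBand A u`) and `N_d = dim 𝒦`.

**Theorem [Mielke 1993; Mielke 1999, §4, last sentence] (`mielke_flatBand_ferromagnetism`).** If the
single-particle density matrix `ρ = (ρ_{xy})` — the orthogonal projection onto the flat band — is
IRREDUCIBLE, then with `N_e = N_d` electrons and any `U > 0` (`t > 0`): the ground-state energy of the
`N_e`-sector is `0` (= `N_e · ε_min`), every ground state has total spin `S = N_e/2`
(`S² ψ = (N_e/2)(N_e/2+1) ψ`), and the ground states are exactly the `(N_e + 1)`-dimensional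
ferromagnetic multiplet ("the ferromagnetic ground state … with `N_e = N_d` electrons is the unique
ground state (up to the spin degeneracy due to the `SU(2)` symmetry) if and only if `ρ_{xy}` is
irreducible" — the "if" direction is formalised here). Irreducibility is stated in the equivalent
coordinate form `FlatBand.IsIrreducible 𝒦`: the flat band admits no splitting
`𝒦 = 𝒦|_S ⊕ 𝒦|_{Sᶜ}` into vectors supported in a set of sites `S` and in its complement with both
parts nonzero (for the range of an orthogonal projection `ρ` this is exactly "`ρ` has no nontrivial
invariant coordinate block", i.e. irreducibility of the matrix `ρ` on its support; [Mielke 1999, §4]: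
"A solution exists, if the set `{ψ_k}` decays in two subsets such that `ψ_k(x)ψ_{k'}(x) = 0` if the
two factors are out of different subsets. This is equivalent to the above condition on the single
particle density matrix `ρ_{x,y}`").

This covers at once Tasaki's cell models (`FlatBandFerromagnetism.lean`), Mielke's line graphs
(kagomé etc., [Mielke 1991a/b]; `FlatBandFerromagnetismLineGraph.lean`) and Lieb-type flat bands.

## The printed proof and its transcription [Mielke 1999, §§3–4]

§3 (choice of the basis): since `rank T = |Λ| - N_d` one finds `N_s - N_d` sites whose rows of `T`
are linearly independent; on the remaining `N_d` sites `D` the flat band is freely parametrised,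
`𝒦 ∋ ψ ↔ ψ|_D`, with the basis `ψ_k`, `ψ_k|_D = δ_k` (`exists_mielkeBasis`: we obtain `D` from the
rank of the coefficient matrix of a basis of `𝒦` — row rank = column rank — and the `ψ_k` from the
bijectivity of the restriction map `𝒦 → ℝ^D`). The complementary vectors
`w_x = δ_x - Σ_{k ∈ D} ψ_k(x) δ_k` (`x ∉ D`) span the row space of `T` (`span_eq_span_mielkeVec`:
`⟨w_x, 𝒦⟩ = 0`, each `u_a` is `Σ_x u_a(x) w_x` modulo a vector supported in `D` and orthogonal to
`𝒦`, hence zero; the reverse inclusion by the dimension count `rank = |Λ| - N_d`), so the many-body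
kernel conditions `C_σ(u_a)Φ = 0` are equivalent to `C_σ(w_x)Φ = 0`, `x ∉ D` — the weighted cell
construction of `FlatBandFerromagnetismWeighted.lean`, whose theorem
`flatBand_ferromagnetism_of_normalForm` is [Mielke 1999, §4] in this basis (elimination, the
single/multi spin-flip conditions `ψ_k(x)ψ_{k'}(x)(α_{k;k} - α_{k';k'}) = 0`, uniqueness per `S^z`
sector). §4's irreducibility enters only through the connectedness of the overlap graph
`k ∼ k' ⇔ ∃ x, ψ_k(x)ψ_{k'}(x) ≠ 0` (`wGraph_preconnected_of_isIrreducible`: a union `D₁` of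
components gives the coordinate splitting `S = D₁ ∪ {x | ∃ k ∈ D₁, ψ_k(x) ≠ 0}`,
`π_S v = Σ_{k ∈ D₁} v(k) ψ_k ∈ 𝒦`).

Scope: the "only if" half (a reducible `ρ` produces further, non-ferromagnetic ground states) is
`mielke_finrank_groundKer_of_not_isIrreducible` / `mielke_isIrreducible_iff` in
`FlatBandFerromagnetismReducible.lean`; the existence of saturated ferromagnetic ground states for every
`N_e ≤ N_d` is `exists_saturated_groundState` in `FlatBandSaturatedGroundStates.lean`; Mielke's §5
(`N_e < N_d`: local stability ⇒ global stability) is not formalised.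

**Corollary (`tasaki_longRange_ferromagnetism`) [Tasaki 1998, Theorem 5.1, arbitrary site
weights].** The long-range hopping model `t_{x,y} = t λ_x λ_y` (`T = t|λ⟩⟨λ|`, all `λ_x ≠ 0`) is the
Gram Hamiltonian of the single vector `λ`; its flat band `λ^⊥` has dimension `N_s - 1` and is
irreducible, so Mielke's theorem gives Tasaki's Theorem 5.1 in the printed generality (the uniform-weight
case is `longRange_ferromagnetism` of `FlatBandFerromagnetism.lean`).

## References

* A. Mielke, *Stability of ferromagnetism in Hubbard models with degenerate single-particle ground
  states*, J. Phys. A **32** (1999) 8411–8418 = arXiv:cond-mat/9910385, §§2–4. [Mielke1999]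
  (held text `paper:arxiv-cond-mat_9910385`, pp. 5–7 read)
* A. Mielke, *Ferromagnetism in the Hubbard model and Hund's rule*, Phys. Lett. A **174** (1993)
  443–448. [Mielke1993]
* H. Tasaki, Prog. Theor. Phys. **99** (1998) 489, §6.5, Theorem 6.2 (Mielke's theorem for line
  graphs). [Tasaki1998PTP]
-/

noncomputable section

open Matrix Finset Module
open scoped ComplexOrder

namespace Literature.MathematicalPhysics.QuantumLattice

namespace FlatBand

variable {Λ : Type*} [LinearOrder Λ] [Fintype Λ]

/-! ### The flat band and Mielke's irreducibility -/

section FlatBandDef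

variable {ι : Type*} (A : Finset ι) (u : ι → Λ → ℝ)

/-- **The flat band** of the Gram hopping `t Σ_a |u_a⟩⟨u_a|`: the common null space
`{v | ⟨u_a, v⟩ = 0 ∀ a ∈ A}` of the hopping vectors, i.e. the (`N_d`-fold degenerate) zero eigenspace
of the single-particle Hamiltonian `T`. [cite: Mielke1999, §2 ("a Hubbard model with `N_d` degenerate
single particle ground states. The energy scale is chosen such that `ε_i = 0` for `i ≤ N_d`") and §3
("the single particle ground states obey `Tψ = 0`")] -/
def flatBand : Submodule ℝ (Λ → ℝ) where
  carrier := {v | ∀ a ∈ A, u a ⬝ᵥ v = 0}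
  add_mem' := by
    intro v v' hv hv' a ha
    simp only [Set.mem_setOf_eq] at hv hv'
    rw [dotProduct_add, hv a ha, hv' a ha, add_zero]
  zero_mem' := by
    intro a _
    exact dotProduct_zero _
  smul_mem' := by
    intro c v hv a ha
    simp only [Set.mem_setOf_eq] at hv
    rw [dotProduct_smul, hv a ha, smul_zero]

variable {A u}

omit [LinearOrder Λ] in
/-- Membership in the flat band. [cite: Mielke1999, §3 (`Tψ = 0`)] -/
theorem mem_flatBand {v : Λ → ℝ} : v ∈ flatBand A u ↔ ∀ a ∈ A, u a ⬝ᵥ v = 0 := Iff.rfl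

end FlatBandDef

/-- The coordinate cut-off of a one-particle vector to a set of sites. [cite: Mielke1999, §4 (splitting
of the flat-band basis into two subsets with disjoint supports)] -/
def cutoff (S : Finset Λ) (v : Λ → ℝ) : Λ → ℝ := fun y => if y ∈ S then v y else 0

/-- **Mielke's irreducibility of the flat band** (coordinate form of the irreducibility of the
single-particle density matrix `ρ_{xy}`): there is no set of sites `S` such that the flat band splits
into vectors supported in `S` plus vectors supported off `S` with both parts nonzero — whenever `𝒦` is
stable under the cut-off to `S`, the flat band vanishes identically on `S` or off `S`.
[cite: Mielke1999, §4 ("the set `{ψ_k(x)}` decays in two subsets such that `ψ_k(x)ψ_{k'}(x) = 0` if the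
two factors are out of different subsets. This is equivalent to the above condition on the single
particle density matrix `ρ_{x,y}`")] [cite: Mielke1993] -/
def IsIrreducible (K : Submodule ℝ (Λ → ℝ)) : Prop :=
  ∀ S : Finset Λ, (∀ v ∈ K, cutoff S v ∈ K) →
    (∀ v ∈ K, ∀ y ∈ S, v y = 0) ∨ (∀ v ∈ K, ∀ y, y ∉ S → v y = 0)

omit [Fintype Λ] in
/-- Unfolding the cut-off. [cite: Mielke1999, §4] -/
theorem cutoff_apply (S : Finset Λ) (v : Λ → ℝ) (y : Λ) :
    cutoff S v y = if y ∈ S then v y else 0 := rfl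

/-! ### Mielke's basis of the flat band (§3: "Choice of the basis") -/

section MielkeBasis

omit [LinearOrder Λ] in
/-- The dot product with a fixed vector vanishes on a span as soon as it vanishes on the generators
(the null space of one vector is the flat band of a one-element family). [cite: Mielke1999, §3] -/
private theorem dotProduct_eq_zero_of_mem_span {c : Λ → ℝ} {S : Set (Λ → ℝ)}
    (hS : ∀ e ∈ S, c ⬝ᵥ e = 0) {e : Λ → ℝ} (he : e ∈ Submodule.span ℝ S) : c ⬝ᵥ e = 0 := by
  have h : Submodule.span ℝ S ≤ flatBand ({()} : Finset Unit) (fun _ => c) :=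
    Submodule.span_le.2 fun e he => (mem_flatBand (A := ({()} : Finset Unit))).2 fun _ _ => hS e he
  exact (mem_flatBand.1 (h he)) () (mem_singleton_self _)

/-- **Mielke's basis** [Mielke 1999, §3]. A subspace `𝒦 ⊆ ℝ^Λ` of dimension `N_d` is freely
parametrised on some set `D` of `N_d` sites: there are `ψ_k ∈ 𝒦` (`k ∈ D`) with `ψ_k|_D = δ_k`, and
every `v ∈ 𝒦` is `Σ_{k ∈ D} v(k) ψ_k` ("one can find `N_s - N_d` rows of `T` which are linear
independent … A basis of single particle ground states can be obtained by choosing … `ψ̄_i(x) = δ_{x,i}`").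
Obtained from a basis of `𝒦`: its coefficient matrix has `N_d` linearly independent rows (row rank =
column rank), and the restriction `𝒦 → ℝ^D` to the corresponding sites is injective, hence bijective.
[cite: Mielke1999, §3 (first two displays and the basis `ℬ = {ψ_i : ψ̄_i(x) = δ_{x,i}}`)] -/
theorem exists_mielkeBasis (K : Submodule ℝ (Λ → ℝ)) :
    ∃ (D : Finset Λ) (ψ : Λ → Λ → ℝ), D.card = finrank ℝ K ∧ (∀ k ∈ D, ψ k ∈ K) ∧
      (∀ k ∈ D, ∀ y ∈ D, ψ k y = if y = k then 1 else 0) ∧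
      (∀ v ∈ K, ∀ y, v y = ∑ k ∈ D, v k * ψ k y) := by
  classical
  set n := finrank ℝ K with hn
  let b : Basis (Fin n) ℝ K := Module.finBasis ℝ K
  -- the coefficient matrix of the basis and its rows
  let V : Matrix Λ (Fin n) ℝ := Matrix.of fun y j => (b j : Λ → ℝ) y
  -- column rank: the columns are the basis vectors, linearly independent in `ℝ^Λ`
  have hcol : V.col = fun j => ((b j : K) : Λ → ℝ) := by
    funext j y; rfl
  have hli_b : LinearIndependent ℝ (fun j => ((b j : K) : Λ → ℝ)) :=
    b.linearIndependent.map' K.subtype (Submodule.ker_subtype K)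
  have hrank : V.rank = n := by
    rw [Matrix.rank_eq_finrank_span_cols, hcol, finrank_span_eq_card hli_b, Fintype.card_fin]
  -- row rank: the rows `ρ_y = (b_j(y))_j` span `ℝ^n`
  have hrow : Submodule.span ℝ (Set.range V.row) = ⊤ := by
    apply Submodule.eq_top_of_finrank_eq
    rw [← Matrix.rank_eq_finrank_span_row, hrank, Module.finrank_fin_fun]
  -- extract `n` linearly independent rows
  obtain ⟨κ, a, ha_inj, hspan, hli⟩ := exists_linearIndependent' (K := ℝ) V.row
  haveI : Finite κ := hli.finite
  letI : Fintype κ := Fintype.ofFinite κ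
  have hcardκ : Fintype.card κ = n := by
    have h := finrank_span_eq_card hli
    rw [hspan, hrow, finrank_top, Module.finrank_fin_fun] at h
    exact h.symm
  set D : Finset Λ := univ.image a with hD
  have hDcard : D.card = n := by
    rw [hD, card_image_of_injective _ ha_inj, card_univ, hcardκ]
  have hmemD : ∀ i : κ, a i ∈ D := fun i => mem_image_of_mem _ (mem_univ i)
  -- injectivity of the restriction to `D`
  have hinj : ∀ v ∈ K, (∀ y ∈ D, v y = 0) → v = 0 := by
    intro v hv hvD
    set c : Fin n → ℝ := fun j => b.repr ⟨v, hv⟩ j with hc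
    have hvsum : v = ∑ j, c j • ((b j : K) : Λ → ℝ) := by
      have h := congrArg Subtype.val (b.sum_repr ⟨v, hv⟩)
      rw [Submodule.coe_sum] at h
      simpa [hc] using h.symm
    -- `c` is orthogonal to every row with index in `D`, hence to everything
    have hrowD : ∀ i : κ, c ⬝ᵥ V.row (a i) = 0 := by
      intro i
      have h := hvD (a i) (hmemD i)
      rw [hvsum] at h
      simp only [Finset.sum_apply, Pi.smul_apply, smul_eq_mul] at h
      rw [dotProduct]
      simpa [Matrix.row, V, Matrix.of_apply, mul_comm] using h
    have hall : ∀ e : Fin n → ℝ, c ⬝ᵥ e = 0 := by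
      intro e
      refine dotProduct_eq_zero_of_mem_span (S := Set.range (V.row ∘ a)) ?_ ?_
      · rintro _ ⟨i, rfl⟩; exact hrowD i
      · rw [hspan, hrow]; exact Submodule.mem_top
    have hc0 : c = 0 := dotProduct_self_eq_zero.1 (hall c)
    rw [hvsum, hc0]
    simp
  -- the restriction map and its bijectivity
  let res : K →ₗ[ℝ] (↥D → ℝ) :=
    { toFun := fun v k => (v : Λ → ℝ) k
      map_add' := by intro v v'; funext k; rfl
      map_smul' := by intro c v; funext k; rfl }
  have hres_inj : Function.Injective res := by
    intro v v' h
    apply Subtype.ext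
    have h0 : ((v - v' : K) : Λ → ℝ) = 0 := by
      refine hinj _ (v - v').2 fun y hy => ?_
      have := congrFun h ⟨y, hy⟩
      simp only [res, LinearMap.coe_mk, AddHom.coe_mk] at this
      rw [Submodule.coe_sub, Pi.sub_apply, this, sub_self]
    rw [Submodule.coe_sub] at h0
    exact sub_eq_zero.1 h0
  have hdim : finrank ℝ K = finrank ℝ (↥D → ℝ) := by
    rw [Module.finrank_fintype_fun_eq_card, Fintype.card_coe, hDcard]
  have hres_surj : Function.Surjective res :=
    (LinearMap.injective_iff_surjective_of_finrank_eq_finrank hdim).1 hres_inj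
  choose pre hpre using hres_surj
  -- Mielke's basis `ψ_k = res⁻¹(δ_k)`
  have key : ∃ Ψ : Λ → Λ → ℝ, (∀ k ∈ D, Ψ k ∈ K) ∧ (∀ k ∈ D, ∀ y ∈ D, Ψ k y = if y = k then 1 else 0) := by
    refine ⟨fun k y => if hk : k ∈ D then ((pre (Pi.single (⟨k, hk⟩ : ↥D) 1) : K) : Λ → ℝ) y else 0,
      ?_, ?_⟩
    · intro k hk
      simp only [dif_pos hk]
      exact (pre _).2
    · intro k hk y hy
      dsimp only
      rw [dif_pos hk]
      have h := congrFun (hpre (Pi.single (⟨k, hk⟩ : ↥D) 1)) ⟨y, hy⟩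
      simp only [res, LinearMap.coe_mk, AddHom.coe_mk] at h
      rw [h, Pi.single_apply]
      simp only [Subtype.mk.injEq]
  obtain ⟨Ψ, hΨK, hΨD⟩ := key
  refine ⟨D, Ψ, hDcard, hΨK, hΨD, fun v hv y => ?_⟩
  have hv'K : (∑ k ∈ D, v k • Ψ k) ∈ K :=
    Submodule.sum_mem _ fun k hk => Submodule.smul_mem _ _ (hΨK k hk)
  have hzero : v - ∑ k ∈ D, v k • Ψ k = 0 := by
    refine hinj _ (Submodule.sub_mem _ hv hv'K) fun z hz => ?_
    rw [Pi.sub_apply, Finset.sum_apply, sub_eq_zero, Finset.sum_eq_single z]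
    · rw [Pi.smul_apply, smul_eq_mul, hΨD z hz z hz, if_pos rfl, mul_one]
    · intro k hk hkz
      rw [Pi.smul_apply, smul_eq_mul, hΨD k hk z hz, if_neg (Ne.symm hkz), mul_zero]
    · intro h; exact absurd hz h
  have h := congrFun hzero y
  rw [Pi.sub_apply, Finset.sum_apply, Pi.zero_apply, sub_eq_zero] at h
  rw [h]
  exact Finset.sum_congr rfl fun k _ => by rw [Pi.smul_apply, smul_eq_mul]

end MielkeBasis

/-! ### The complementary vectors `w_x` and the row space of `T` -/

section NormalForm

variable (D : Finset Λ) (ψ : Λ → Λ → ℝ)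

/-- Mielke's complementary vectors `w_x = δ_x - Σ_{k ∈ D} ψ_k(x) δ_k` (`x ∉ D`): the weighted normal form
of the row space of `T`. [cite: Mielke1999, §3 (the block form `T = (C 1)ᵀ T₀ (C 1)` with
`ψ = (ψ̄, -Cψ̄)`)] -/
def mielkeVec : Λ → Λ → ℝ := fun x y => if y = x then 1 else if y ∈ D then -ψ y x else 0

variable {D ψ}

omit [Fintype Λ] in
/-- `w_x(x) = 1`. [cite: Mielke1999, §3] -/
theorem mielkeVec_self (x : Λ) : mielkeVec D ψ x x = 1 := by simp [mielkeVec]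

omit [Fintype Λ] in
/-- `w_x(k) = -ψ_k(x)` for `k ∈ D`, `x ∉ D`. [cite: Mielke1999, §3] -/
theorem mielkeVec_of_mem {x k : Λ} (hx : x ∉ D) (hk : k ∈ D) : mielkeVec D ψ x k = -ψ k x := by
  have hkx : k ≠ x := fun h => hx (h ▸ hk)
  simp [mielkeVec, hkx, hk]

omit [Fintype Λ] in
/-- `w_x` is supported in `{x} ∪ D`. [cite: Mielke1999, §3] -/
theorem mielkeVec_of_notMem {x y : Λ} (hyx : y ≠ x) (hy : y ∉ D) : mielkeVec D ψ x y = 0 := by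
  simp [mielkeVec, hyx, hy]

/-- **`⟨w_x, v⟩ = 0` on the flat band**: for `v ∈ 𝒦` (expanded as `Σ_k v(k)ψ_k`) and `x ∉ D`,
`⟨w_x, v⟩ = v(x) - Σ_{k ∈ D} ψ_k(x) v(k) = 0`. [cite: Mielke1999, §3 ("`Tψ = 0` … holds if and only
if `ψ = (ψ̄, -Cψ̄)`")] -/
theorem mielkeVec_dotProduct_eq_zero {K : Submodule ℝ (Λ → ℝ)}
    (hexp : ∀ v ∈ K, ∀ y, v y = ∑ k ∈ D, v k * ψ k y) {x : Λ} (hx : x ∉ D) {v : Λ → ℝ}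
    (hv : v ∈ K) : mielkeVec D ψ x ⬝ᵥ v = 0 := by
  classical
  rw [dotProduct, ← Finset.add_sum_erase _ _ (mem_univ x), mielkeVec_self, one_mul]
  have hsplit : ∑ y ∈ univ.erase x, mielkeVec D ψ x y * v y = ∑ k ∈ D, -ψ k x * v k := by
    have hsub : D ⊆ univ.erase x := fun k hk => mem_erase.2 ⟨fun h => hx (h ▸ hk), mem_univ k⟩
    rw [← Finset.sum_subset hsub (fun y hy hyD => by
      rw [mielkeVec_of_notMem (ne_of_mem_erase hy) hyD, zero_mul])]
    exact sum_congr rfl fun k hk => by rw [mielkeVec_of_mem hx hk]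
  rw [hsplit, hexp v hv x, ← Finset.sum_add_distrib]
  exact Finset.sum_eq_zero fun k _ => by ring

/-- **The row space in Mielke's basis** (§3): if `𝒦 = flatBand A u` is expanded on `D` by `ψ`, the span
of the hopping vectors `u_a` equals the span of the complementary vectors `w_x`, `x ∉ D`. (`⊆`: each
`u_a - Σ_x u_a(x) w_x` is supported in `D` and orthogonal to every `ψ_k`, hence zero; `⊇`: the dimension
count `rank T = |Λ| - N_d`.) [cite: Mielke1999, §3 ("Since `rank T = N_s - N_d`, one can find
`N_s - N_d` rows (or columns) of `T` which are linear independent … The other matrix elements of `T` are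
fixed")] -/
theorem span_eq_span_mielkeVec {ι : Type*} {A : Finset ι} {u : ι → Λ → ℝ}
    (hcard : D.card = finrank ℝ (flatBand A u)) (hψK : ∀ k ∈ D, ψ k ∈ flatBand A u)
    (hψD : ∀ k ∈ D, ∀ y ∈ D, ψ k y = if y = k then 1 else 0)
    (hexp : ∀ v ∈ flatBand A u, ∀ y, v y = ∑ k ∈ D, v k * ψ k y) :
    Submodule.span ℝ (u '' (A : Set ι)) =
      Submodule.span ℝ (mielkeVec D ψ '' ((Dᶜ : Finset Λ) : Set Λ)) := by
  classical
  set K := flatBand A u with hK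
  set W := Submodule.span ℝ (mielkeVec D ψ '' ((Dᶜ : Finset Λ) : Set Λ)) with hW
  -- `⊆`
  have hle : Submodule.span ℝ (u '' (A : Set ι)) ≤ W := by
    rw [Submodule.span_le]
    rintro _ ⟨a, ha, rfl⟩
    have ha' : a ∈ A := ha
    -- `r = u_a - Σ_{x ∉ D} u_a(x) w_x` vanishes
    set r : Λ → ℝ := u a - ∑ x ∈ Dᶜ, u a x • mielkeVec D ψ x with hr
    have hr_out : ∀ y, y ∉ D → r y = 0 := by
      intro y hy
      rw [hr, Pi.sub_apply, Finset.sum_apply, Finset.sum_eq_single y]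
      · rw [Pi.smul_apply, smul_eq_mul, mielkeVec_self, mul_one, sub_self]
      · intro x hx hxy
        rw [Pi.smul_apply, smul_eq_mul, mielkeVec_of_notMem (Ne.symm hxy) hy, mul_zero]
      · intro h; exact absurd (mem_compl.2 hy) h
    have hr_orth : ∀ k ∈ D, r ⬝ᵥ ψ k = 0 := by
      intro k hk
      rw [hr, sub_dotProduct, sum_dotProduct, (mem_flatBand.1 (hψK k hk)) a ha']
      rw [Finset.sum_eq_zero, sub_zero]
      intro x hx
      rw [smul_dotProduct, mielkeVec_dotProduct_eq_zero hexp (mem_compl.1 hx) (hψK k hk), smul_zero]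
    have hr_in : ∀ k ∈ D, r k = 0 := by
      intro k hk
      have h := hr_orth k hk
      rw [dotProduct, ← Finset.sum_subset (subset_univ D), Finset.sum_eq_single k] at h
      · rwa [hψD k hk k hk, if_pos rfl, mul_one] at h
      · intro y hy hyk
        rw [hψD k hk y hy, if_neg hyk, mul_zero]
      · intro h'; exact absurd hk h'
      · intro y _ hyD
        rw [hr_out y hyD, zero_mul]
    have hr0 : r = 0 := funext fun y => by
      by_cases hy : y ∈ D
      · exact hr_in y hy
      · exact hr_out y hy
    have hua : u a = ∑ x ∈ Dᶜ, u a x • mielkeVec D ψ x := by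
      rw [← sub_eq_zero]; exact hr0
    rw [hua]
    exact Submodule.sum_mem _ fun x hx => Submodule.smul_mem _ _
      (Submodule.subset_span ⟨x, hx, rfl⟩)
  -- `⊇` by dimensions
  refine Submodule.eq_of_le_of_finrank_le hle ?_
  -- `finrank W ≤ |Dᶜ|`
  have hW_le : finrank ℝ W ≤ (Dᶜ : Finset Λ).card := by
    rw [hW, ← Finset.coe_image]
    exact (finrank_span_finset_le_card _).trans Finset.card_image_le
  -- `finrank (span u) = |Λ| - N_d` by rank–nullity for the coefficient matrix of the `u_a`
  let M : Matrix (A : Set ι) Λ ℝ := Matrix.of fun a y => u a y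
  have hker : LinearMap.ker M.mulVecLin = K := by
    ext v
    rw [LinearMap.mem_ker, Matrix.mulVecLin_apply, hK, mem_flatBand]
    constructor
    · intro h a ha
      have := congrFun h ⟨a, ha⟩
      simpa [Matrix.mulVec, M] using this
    · intro h
      funext a
      simpa [Matrix.mulVec, M] using h a a.2
  have hrow : Set.range M.row = u '' (A : Set ι) := by
    ext e
    simp only [Set.mem_range, Set.mem_image, Finset.mem_coe]
    constructor
    · rintro ⟨a, rfl⟩; exact ⟨a, a.2, rfl⟩
    · rintro ⟨a, ha, rfl⟩; exact ⟨⟨a, ha⟩, rfl⟩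
  have hrn : finrank ℝ (Submodule.span ℝ (u '' (A : Set ι))) + finrank ℝ K = Fintype.card Λ := by
    rw [← hrow, ← Matrix.rank_eq_finrank_span_row, Matrix.rank, ← hker,
      LinearMap.finrank_range_add_finrank_ker, Module.finrank_fintype_fun_eq_card]
  have hcc : (Dᶜ : Finset Λ).card + D.card = Fintype.card Λ := by
    rw [Finset.card_compl, Nat.sub_add_cancel (Finset.card_le_univ D)]
  omega

/-! ### Irreducibility ⇒ connectedness of the overlap graph -/

omit [Fintype Λ] in
/-- In Mielke's basis the overlap graph of the complementary vectors is `k ∼ k' ⇔ k ≠ k' ∧ ∃ x ∉ D,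
ψ_k(x) ψ_{k'}(x) ≠ 0`. [cite: Mielke1999, §4 (the condition `ψ_k(x)ψ_{k'}(x)(α_{k;k} - α_{k';k'}) = 0`)] -/
theorem wGraph_mielkeVec_adj_iff {k k' : ↥D} :
    (wGraph D (mielkeVec D ψ)).Adj k k' ↔ k ≠ k' ∧ ∃ x, x ∉ D ∧ ψ k x ≠ 0 ∧ ψ k' x ≠ 0 := by
  rw [wGraph_adj_iff]
  refine and_congr_right fun _ => exists_congr fun x => and_congr_right fun hx => ?_
  rw [mielkeVec_of_mem hx k.2, mielkeVec_of_mem hx k'.2, neg_ne_zero, neg_ne_zero]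

/-- **Irreducibility ⇒ the overlap graph is connected** [Mielke 1999, §4]: if the overlap graph of
Mielke's basis were disconnected, the sites `S = D₁ ∪ {x ∉ D | ∃ k ∈ D₁, ψ_k(x) ≠ 0}` of a component
union `D₁` would split the flat band (`π_S v = Σ_{k ∈ D₁} v(k)ψ_k ∈ 𝒦`) with both parts nonzero.
[cite: Mielke1999, §4 ("A solution exists, if the set `{ψ_k}` decays in two subsets such that
`ψ_k(x)ψ_{k'}(x) = 0` if the two factors are out of different subsets")] -/
theorem wGraph_preconnected_of_isIrreducible {K : Submodule ℝ (Λ → ℝ)} (hirr : IsIrreducible K)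
    (hψK : ∀ k ∈ D, ψ k ∈ K) (hψD : ∀ k ∈ D, ∀ y ∈ D, ψ k y = if y = k then 1 else 0)
    (hexp : ∀ v ∈ K, ∀ y, v y = ∑ k ∈ D, v k * ψ k y) :
    (wGraph D (mielkeVec D ψ)).Preconnected := by
  classical
  set G := wGraph D (mielkeVec D ψ) with hG
  intro k₀ k₁
  by_contra hnr
  -- the component of `k₀`, as a set of sites, and the splitting set `S`
  set D₁ : Finset Λ := (D.attach.filter fun k => G.Reachable k₀ k).map (Function.Embedding.subtype _)
    with hD₁
  have hmemD₁ : ∀ y, y ∈ D₁ ↔ ∃ hy : y ∈ D, G.Reachable k₀ ⟨y, hy⟩ := by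
    intro y
    simp only [hD₁, mem_map, mem_filter, mem_attach, true_and, Function.Embedding.coe_subtype,
      Subtype.exists, exists_and_right, exists_eq_right]
  have hD₁D : D₁ ⊆ D := fun y hy => ((hmemD₁ y).1 hy).1
  set S : Finset Λ := D₁ ∪ (Dᶜ : Finset Λ).filter (fun x => ∃ k ∈ D₁, ψ k x ≠ 0) with hS
  -- across the component boundary there is no overlap
  have hcross : ∀ x, x ∉ D → ∀ k ∈ D₁, ψ k x ≠ 0 → ∀ k' ∈ D, k' ∉ D₁ → ψ k' x = 0 := by
    intro x hx k hk hkx k' hk' hk'₁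
    by_contra hne
    obtain ⟨hkD, hreach⟩ := (hmemD₁ k).1 hk
    have hkk' : (⟨k, hkD⟩ : ↥D) ≠ ⟨k', hk'⟩ := by
      intro h
      apply hk'₁
      rw [hmemD₁]
      exact ⟨hk', h ▸ hreach⟩
    have hadj : G.Adj ⟨k, hkD⟩ ⟨k', hk'⟩ :=
      wGraph_mielkeVec_adj_iff.2 ⟨hkk', x, hx, hkx, hne⟩
    exact hk'₁ ((hmemD₁ k').2 ⟨hk', hreach.trans hadj.reachable⟩)
  -- `π_S v = Σ_{k ∈ D₁} v(k) ψ_k ∈ K`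
  have hstable : ∀ v ∈ K, cutoff S v ∈ K := by
    intro v hv
    have heq : cutoff S v = ∑ k ∈ D₁, v k • ψ k := by
      funext y
      rw [cutoff_apply, Finset.sum_apply]
      simp only [Pi.smul_apply, smul_eq_mul]
      by_cases hyD : y ∈ D
      · -- on `D`, `ψ_k(y) = δ_{ky}`
        have hyS : y ∈ S ↔ y ∈ D₁ := by
          rw [hS, mem_union, mem_filter, mem_compl]
          exact ⟨fun h => h.elim id fun h => absurd hyD h.1, fun h => Or.inl h⟩
        by_cases hy₁ : y ∈ D₁
        · rw [if_pos (hyS.2 hy₁), Finset.sum_eq_single y]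
          · rw [hψD y hyD y hyD, if_pos rfl, mul_one]
          · intro k hk hky
            rw [hψD k (hD₁D hk) y hyD, if_neg (Ne.symm hky), mul_zero]
          · intro h; exact absurd hy₁ h
        · rw [if_neg (fun h => hy₁ (hyS.1 h))]
          symm
          refine Finset.sum_eq_zero fun k hk => ?_
          rw [hψD k (hD₁D hk) y hyD, if_neg (fun h : y = k => hy₁ (h ▸ hk)), mul_zero]
      · by_cases hex : ∃ k ∈ D₁, ψ k y ≠ 0
        · have hyS : y ∈ S := by
            rw [hS, mem_union, mem_filter, mem_compl]
            exact Or.inr ⟨hyD, hex⟩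
          rw [if_pos hyS, hexp v hv y, ← Finset.sum_subset hD₁D]
          intro k hk hk₁
          obtain ⟨k₂, hk₂, hk₂y⟩ := hex
          rw [hcross y hyD k₂ hk₂ hk₂y k hk hk₁, mul_zero]
        · have hyS : y ∉ S := by
            rw [hS, mem_union, mem_filter, mem_compl, not_or]
            exact ⟨fun h => hyD (hD₁D h), fun h => hex h.2⟩
          rw [if_neg hyS]
          symm
          refine Finset.sum_eq_zero fun k hk => ?_
          push Not at hex
          rw [hex k hk, mul_zero]
    rw [heq]
    exact Submodule.sum_mem _ fun k hk => Submodule.smul_mem _ _ (hψK k (hD₁D hk))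
  -- both alternatives of irreducibility fail
  have hk₀D₁ : (k₀ : Λ) ∈ D₁ := (hmemD₁ k₀).2 ⟨k₀.2, SimpleGraph.Reachable.refl _⟩
  have hk₁D₁ : (k₁ : Λ) ∉ D₁ := fun h => hnr (by
    obtain ⟨_, hr⟩ := (hmemD₁ k₁).1 h
    exact hr)
  rcases hirr S hstable with h | h
  · have := h (ψ k₀) (hψK k₀ k₀.2) k₀ (by rw [hS, mem_union]; exact Or.inl hk₀D₁)
    rw [hψD k₀ k₀.2 k₀ k₀.2, if_pos rfl] at this
    exact one_ne_zero this
  · have hk₁S : (k₁ : Λ) ∉ S := by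
      rw [hS, mem_union, mem_filter, mem_compl, not_or]
      exact ⟨hk₁D₁, fun h' => h'.1 k₁.2⟩
    have := h (ψ k₁) (hψK k₁ k₁.2) k₁ hk₁S
    rw [hψD k₁ k₁.2 k₁ k₁.2, if_pos rfl] at this
    exact one_ne_zero this

end NormalForm

/-! ### Mielke's theorem -/

section Main

variable {ι : Type*} (A : Finset ι) (u : ι → Λ → ℝ) {t U : ℝ}

/-- **Mielke's flat-band ferromagnetism theorem** [Mielke 1993; Mielke 1999, §4]. Consider the Hubbard
model `H = Σ_{x,y,σ} t_{xy} c†_{xσ}c_{yσ} + U Σ_x n_{x↑}n_{x↓}` with a positive semidefinite hopping matrix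
`t_{xy} = t Σ_a u_a(x)u_a(y)` (`t > 0`), `U > 0`, whose single-particle ground space — the flat band
`𝒦 = {v | ⟨u_a, v⟩ = 0 ∀ a}` — has dimension `N_d`. If the single-particle density matrix of the flat
band is irreducible (coordinate form `FlatBand.IsIrreducible 𝒦`), then with `N_e = N_d` electrons the
ground-state energy is `0`, every ground state is ferromagnetic with `S = N_e/2`
(`S² ψ = (N_e/2)(N_e/2 + 1) ψ`), and the ground states form exactly the `(N_e+1)`-dimensional `SU(2)`
multiplet ("the ferromagnetic ground state … with `N_e = N_d` electrons is the unique ground state (up to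
the spin degeneracy due to the `SU(2)` symmetry) if … `ρ_{xy}` is irreducible").
[cite: Mielke1999, §2 (Theorem, case `N_e = N_d`) and §4 (last sentence)] [cite: Mielke1993] -/
theorem mielke_flatBand_ferromagnetism (ht : 0 < t) (hU : 0 < U) (hirr : IsIrreducible (flatBand A u)) :
    groundEnergy (gramHamiltonian A u t U) (finrank ℝ (flatBand A u)) = 0 ∧
      (∀ ψ : Fock (Orb Λ), IsGroundState (gramHamiltonian A u t U) (finrank ℝ (flatBand A u)) ψ →
        spinSq *ᵥ ψ = ((((finrank ℝ (flatBand A u) : ℝ) / 2) *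
          ((finrank ℝ (flatBand A u) : ℝ) / 2 + 1) : ℝ) : ℂ) • ψ) ∧
      Module.finrank ℂ ↥(LinearMap.ker (Matrix.toLin' (gramHamiltonian A u t U -
          ((groundEnergy (gramHamiltonian A u t U) (finrank ℝ (flatBand A u)) : ℝ) : ℂ) • 1)) ⊓
        LinearMap.ker (Matrix.toLin' (totalNumber -
          (finrank ℝ (flatBand A u) : ℂ) • (1 : Matrix (Finset (Orb Λ)) _ ℂ)))) =
        finrank ℝ (flatBand A u) + 1 := by
  obtain ⟨D, ψ, hcard, hψK, hψD, hexp⟩ := exists_mielkeBasis (flatBand A u)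
  rw [← hcard]
  have hw0 : ∀ x, x ∉ D → mielkeVec D ψ x x ≠ 0 := fun x _ => by
    rw [mielkeVec_self]; exact one_ne_zero
  have hwD : ∀ x, x ∉ D → ∀ y, y ≠ x → y ∉ D → mielkeVec D ψ x y = 0 :=
    fun x _ y hyx hy => mielkeVec_of_notMem hyx hy
  exact flatBand_ferromagnetism_of_normalForm (D := D) (w := mielkeVec D ψ) A u hw0 hwD
    (span_eq_span_mielkeVec hcard hψK hψD hexp) (wGraph_preconnected_of_isIrreducible hirr hψK hψD hexp) ht hU

end Main

/-! ### Corollary: Tasaki's long-range hopping model with arbitrary site weights (Theorem 5.1) -/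

section TasakiLongRange

variable (lam : Λ → ℝ) (t U : ℝ)

/-- **Tasaki's long-range hopping model** [Tasaki 1998, §5.1]: site weights `λ_x` and hopping
`t_{x,y} = t λ_x λ_y` for ALL pairs `x, y` (diagonal entries = on-site potentials `t λ_x²` included),
i.e. `T = t |λ⟩⟨λ|` ("the Dirac notation `T = t|λ⟩⟨λ|` may be more informative"), and
`H = Σ_{x,y,σ} t_{xy} c†_{xσ}c_{yσ} + U Σ_x n_{x↑}n_{x↓}`: the Gram Hamiltonian of the one-element
family `{λ}`. The uniform-weight family `longRangeHamiltonian` of `FlatBandFerromagnetism.lean` is the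
special case `λ_{x₀} = λ`, `λ_x = 1` (`x ≠ x₀`) (`longRangeHamiltonian_eq_tasakiLongRangeHamiltonian`).
[cite: Tasaki1998PTP, §5.1 (hopping `t_{x,y} = t λ_x λ_y`, first display, and footnote `T = t|λ⟩⟨λ|`)] -/
def tasakiLongRangeHamiltonian : Matrix (Finset (Orb Λ)) (Finset (Orb Λ)) ℂ :=
  gramHamiltonian ({()} : Finset Unit) (fun _ => lam) t U

omit [LinearOrder Λ] [Fintype Λ] in
/-- The Gram hopping of the single vector `λ` is `t λ_x λ_y`. [cite: Tasaki1998PTP, §5.1 (`T = t|λ⟩⟨λ|`)] -/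
theorem gramHopping_singleton (y z : Λ) :
    gramHopping ({()} : Finset Unit) (fun _ => lam) t y z = t * (lam y * lam z) := by
  simp [gramHopping]

/-- Unfolding: `H = B(t λ ⊗ λ) + U Σ_x n_{x↑}n_{x↓}`. [cite: Tasaki1998PTP, §5.1] -/
theorem tasakiLongRangeHamiltonian_eq :
    tasakiLongRangeHamiltonian lam t U =
      hoppingOp (fun y z => t * (lam y * lam z)) + (U : ℂ) • onSiteRepulsion := by
  rw [tasakiLongRangeHamiltonian, gramHamiltonian,
    show gramHopping ({()} : Finset Unit) (fun _ => lam) t = fun y z => t * (lam y * lam z) from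
      funext fun y => funext fun z => gramHopping_singleton lam t y z]

/-- The uniform-weight model `longRangeHamiltonian t λ U x₀` of `FlatBandFerromagnetism.lean`
(`λ_{x₀} = λ`, `λ_x = 1` otherwise) is Tasaki's model for these site weights.
[cite: Tasaki1998PTP, §5.1 (hopping `t_{x,y} = t λ_x λ_y`)] -/
theorem longRangeHamiltonian_eq_tasakiLongRangeHamiltonian (t lam U : ℝ) (x₀ : Λ) :
    longRangeHamiltonian t lam U x₀ =
      tasakiLongRangeHamiltonian (fun x => if x = x₀ then lam else 1) t U := by
  rw [longRangeHamiltonian, hamiltonian, tasakiLongRangeHamiltonian_eq,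
    show cellHopping (univ.erase x₀) (fun _ => univ.erase x₀) t lam =
        fun x y => t * ((if x = x₀ then lam else 1) * (if y = x₀ then lam else 1)) from
      funext fun x => funext fun y => cellHopping_longRange t lam x₀ x y]

variable {lam}

omit [LinearOrder Λ] in
/-- The flat band of `T = t|λ⟩⟨λ|` is the orthogonal complement `{v | ⟨λ, v⟩ = 0}` ("the
single-electron equation becomes `t λ ⟨λ, φ⟩ = ε φ`": zero modes = `⟨λ, φ⟩ = 0`).
[cite: Tasaki1998PTP, §5.1 (single-electron equation for `T = t|λ⟩⟨λ|`)] -/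
theorem mem_flatBand_singleton {v : Λ → ℝ} :
    v ∈ flatBand ({()} : Finset Unit) (fun _ => lam) ↔ lam ⬝ᵥ v = 0 := by
  rw [mem_flatBand]
  simp

omit [LinearOrder Λ] in
/-- **The flat band of the long-range model has dimension `|Λ| - 1`** (`λ ≠ 0`; rank–nullity for
the functional `⟨λ, ·⟩`): "`ε = 0` … is `(N_s - 1)`-fold degenerate". [cite: Tasaki1998PTP, §5.1
(degeneracy `N_s - 1` of the zero eigenvalue)] -/
theorem finrank_flatBand_singleton_add_one (hlam : lam ≠ 0) :
    finrank ℝ (flatBand ({()} : Finset Unit) (fun _ => lam)) + 1 = Fintype.card Λ := by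
  classical
  set M : Matrix Unit Λ ℝ := Matrix.of fun _ l => lam l with hM
  have hmul : ∀ v : Λ → ℝ, M *ᵥ v = fun _ => lam ⬝ᵥ v := by
    intro v; funext i; rfl
  have hker : LinearMap.ker M.mulVecLin = flatBand ({()} : Finset Unit) (fun _ => lam) := by
    ext v
    rw [LinearMap.mem_ker, Matrix.mulVecLin_apply, mem_flatBand_singleton, hmul]
    constructor
    · intro h; exact congrFun h ()
    · intro h; funext i; exact h
  have hrange : finrank ℝ (LinearMap.range M.mulVecLin) = 1 := by
    apply le_antisymm
    · calc finrank ℝ (LinearMap.range M.mulVecLin) ≤ finrank ℝ (Unit → ℝ) := Submodule.finrank_le _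
        _ = 1 := by simp
    · rw [Nat.one_le_iff_ne_zero, Ne, Submodule.finrank_eq_zero]
      intro h
      have hmem : M.mulVecLin lam ∈ LinearMap.range M.mulVecLin := LinearMap.mem_range_self _ _
      rw [h, Submodule.mem_bot, Matrix.mulVecLin_apply, hmul] at hmem
      have h2 : lam ⬝ᵥ lam = 0 := congrFun hmem ()
      exact hlam (dotProduct_self_eq_zero.1 h2)
  have h := LinearMap.finrank_range_add_finrank_ker M.mulVecLin
  rw [hrange, hker, Module.finrank_fintype_fun_eq_card] at h
  omega

/-- **The flat band of the long-range model is irreducible** (all `λ_x ≠ 0`): a coordinate splitting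
`S ⊔ Sᶜ` with both parts inhabited would have to cut `λ_y δ_x - λ_x δ_y ∈ 𝒦` (`x ∈ S`, `y ∉ S`) into
`λ_y δ_x ∉ 𝒦` — "an electron can hop from any site in the lattice to any other site".
[cite: Tasaki1998PTP, §5.1] [cite: Mielke1999, §4] -/
theorem isIrreducible_flatBand_singleton (hlam : ∀ x, lam x ≠ 0) :
    IsIrreducible (flatBand ({()} : Finset Unit) (fun _ => lam)) := by
  classical
  intro S hS
  by_cases h1 : ∃ x, x ∈ S
  · by_cases h2 : ∃ y, y ∉ S
    · obtain ⟨x, hx⟩ := h1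
      obtain ⟨y, hy⟩ := h2
      exfalso
      have hyx : y ≠ x := fun h => hy (h ▸ hx)
      set v : Λ → ℝ := lam y • (Pi.single x 1 : Λ → ℝ) - lam x • (Pi.single y 1 : Λ → ℝ) with hv
      have hvK : v ∈ flatBand ({()} : Finset Unit) (fun _ => lam) := by
        rw [mem_flatBand_singleton, hv, dotProduct_sub, dotProduct_smul, dotProduct_smul, dotProduct_single,
          dotProduct_single, smul_eq_mul, smul_eq_mul]
        ring
      have hcutv : cutoff S v = lam y • (Pi.single x 1 : Λ → ℝ) := by
        funext z
        rw [cutoff_apply, hv, Pi.sub_apply, Pi.smul_apply, Pi.smul_apply]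
        by_cases hz : z ∈ S
        · have hzy : z ≠ y := fun h => hy (h ▸ hz)
          rw [if_pos hz, Pi.single_eq_of_ne hzy, smul_zero, sub_zero]
        · have hzx : z ≠ x := fun h => hz (h ▸ hx)
          rw [if_neg hz, Pi.single_eq_of_ne hzx, smul_zero]
      have hcut := hS v hvK
      rw [hcutv, mem_flatBand_singleton, dotProduct_smul, dotProduct_single, smul_eq_mul, mul_one] at hcut
      exact mul_ne_zero (hlam y) (hlam x) hcut
    · exact Or.inr fun v _ y hy' => absurd ⟨y, hy'⟩ h2
  · exact Or.inl fun v _ y hy' => absurd ⟨y, hy'⟩ h1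

variable {t U}

/-- **Ferromagnetism in the long-range hopping model** [Tasaki 1998, Theorem 5.1] with ARBITRARY site
weights (printed: `λ_x > 0`; the proof needs only `λ_x ≠ 0`, the sign being a gauge `c_x ↦ -c_x`): for
the hopping `t_{x,y} = t λ_x λ_y`, `t > 0`, electron number `N_e = N_s - 1` and any `U > 0`, the
ground-state energy is `0`, every ground state has total spin `S_tot = S_max = N_e/2`
(`S² ψ = S_max(S_max + 1) ψ`), and the ground states are non-degenerate apart from the trivial
`(2 S_max + 1)`-fold degeneracy (ground multiplet of dimension exactly `N_e + 1`). Closes the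
`TODO(general form)` of `longRange_ferromagnetism` (uniform weights) in `FlatBandFerromagnetism.lean`;
obtained from `mielke_flatBand_ferromagnetism` for the one-element family `{λ}`.
[cite: Tasaki1998PTP, §5.1, Theorem 5.1] [cite: Mielke1999, §4] -/
theorem tasaki_longRange_ferromagnetism (hlam : ∀ x, lam x ≠ 0) (ht : 0 < t) (hU : 0 < U) :
    groundEnergy (tasakiLongRangeHamiltonian lam t U) (Fintype.card Λ - 1) = 0 ∧
      (∀ ψ : Fock (Orb Λ), IsGroundState (tasakiLongRangeHamiltonian lam t U) (Fintype.card Λ - 1) ψ →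
        spinSq *ᵥ ψ = (((((Fintype.card Λ - 1 : ℕ) : ℝ) / 2) *
          (((Fintype.card Λ - 1 : ℕ) : ℝ) / 2 + 1) : ℝ) : ℂ) • ψ) ∧
      Module.finrank ℂ ↥(LinearMap.ker (Matrix.toLin' (tasakiLongRangeHamiltonian lam t U -
          ((groundEnergy (tasakiLongRangeHamiltonian lam t U) (Fintype.card Λ - 1) : ℝ) : ℂ) • 1)) ⊓
        LinearMap.ker (Matrix.toLin' (totalNumber -
          ((Fintype.card Λ - 1 : ℕ) : ℂ) • (1 : Matrix (Finset (Orb Λ)) _ ℂ)))) =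
        Fintype.card Λ - 1 + 1 := by
  by_cases hΛ : Nonempty Λ
  · obtain ⟨x₀⟩ := hΛ
    have hne : lam ≠ 0 := fun h => hlam x₀ (by rw [h]; rfl)
    have hN : finrank ℝ (flatBand ({()} : Finset Unit) (fun _ => lam)) = Fintype.card Λ - 1 := by
      have := finrank_flatBand_singleton_add_one hne
      omega
    obtain ⟨h1, h2, h3⟩ := mielke_flatBand_ferromagnetism ({()} : Finset Unit) (fun _ => lam) ht hU
      (isIrreducible_flatBand_singleton hlam)
    rw [hN] at h1 h2 h3
    exact ⟨h1, h2, h3⟩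
  · -- `Λ = ∅`: `N_e = 0`; still an instance of Mielke's theorem (the flat band is `0`-dimensional)
    have hcard : Fintype.card Λ = 0 := Fintype.card_eq_zero_iff.2 (not_nonempty_iff.1 hΛ)
    have hK : finrank ℝ (flatBand ({()} : Finset Unit) (fun _ => lam)) = Fintype.card Λ - 1 := by
      have hle := Submodule.finrank_le (flatBand ({()} : Finset Unit) (fun _ => lam))
      rw [Module.finrank_fintype_fun_eq_card, hcard] at hle
      rw [hcard]
      omega
    obtain ⟨h1, h2, h3⟩ := mielke_flatBand_ferromagnetism ({()} : Finset Unit) (fun _ => lam) ht hU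
      (isIrreducible_flatBand_singleton hlam)
    rw [hK] at h1 h2 h3
    exact ⟨h1, h2, h3⟩

end TasakiLongRange

end FlatBand

end Literature.MathematicalPhysics.QuantumLattice
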